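import Mathlib
import Summits.NavierStokesRegularity.NavierStokesRegularity.Theorems.FilamentSkeletonRssClause13ModelSliceEstimate

/-!
# Clause 13-J/13-R, brick n3 LAYER C (generic ELLIPTIC WINDOW): if the self symbol has one sign and size `≥ κ` on the spectrum of `Y`, then
# `G·κ·‖Y‖₂² ≤ (‖𝓛Y‖₂ + Λ‖(τ−c)Y′‖₂ + (b₁+b₂)‖Y‖₂)·‖Y‖₂`

Route `FilamentSkeletonRss`, ∃-side clause 13 (`Clause13RNearStraightL` stmt-NavierStokesRegularity-23612; typing-agnostic); design
`filament-plan/DESIGN-28296-model-gluing-g16-v2-addendum.md` §A/§C (pieces S1 and MID).  The landed slice lemmas (`modelSelfForm_re_le_of_lowSlice`,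
`modelSelfForm_re_ge_of_highSlice`, p672737/p673066) hard-wire particular windows; the gluing needs the GENERIC form — a pointwise bound of one sign on the
symbol `(2/q)𝔖(z√q)` wherever the transform `Ŷ(z) = ∫Y e^{izx}` is nonzero — so that the certified windows (`liaSym_le_neg_window` p698454,
`liaSym_le_of_mem_lowSlice`, `liaSym_ge_of_mem_highSlice`) can be plugged in with Γ-dependent cut points:

* §1 `spectralForm_le_of_symbol_le` / `spectralForm_ge_of_symbol_ge` — `(1/2π)∫(2/q)𝔖|Ŷ|² ≤ −κ∫‖Y‖²` (resp. `≥ κ∫‖Y‖²`) from the pointwise symbol bound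
  on the spectrum (Plancherel `…integral_norm_sq_fourierIntegral_eq`);  `modelSelfForm_re_le_of_symbol_le` / `…_ge_of_symbol_ge` — the same for
  `Re 𝔔_ℂ(Y)` via `modelSelfForm_eq_spectral`;
* §2 `model_window_estimate_of_symbol_le` / `model_window_estimate_of_symbol_ge` — **`G·κ·∫‖Y‖² ≤ ((∫‖𝓛Y‖²)^{1/2} + Λ(∫‖(τ−c)Y′‖²)^{1/2} +
  (b₁+b₂)(∫‖Y‖²)^{1/2})·(∫‖Y‖²)^{1/2}`** for the full 1-D model operator (from `model_selfForm_bound`, p696039).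
Lane ns-filament-19175-p1 g16; `--supports stmt-NavierStokesRegularity-23612 --as helper`.
HONEST FRAMING: inequalities about an explicit 1-D model operator attached to a HYPOTHETICAL filament skeleton on the NEGATIVE side of a MODEL route;
nothing here bears on Navier–Stokes regularity or blow-up.
-/

noncomputable section

open MeasureTheory Real Complex Filter Set
open scoped FourierTransform ComplexConjugate Topology
open Summit.NavierStokesRegularity.NavierStokesRegularity.Theorems.AnalyticStripLiaSymbol (liaSym)

namespace Summit.NavierStokesRegularity.NavierStokesRegularity.Theorems.MatchedKernel
set_option linter.dupNamespace false

/-! ## §1 Generic one-signed windows for the model self form -/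

/-- **Negative window, spectral side**: if `(2/q)𝔖(z√q) ≤ −κ` wherever `Ŷ(z) ≠ 0` then `(1/2π)∫(2/q)𝔖(z√q)|Ŷ|² ≤ −κ·∫‖Y‖²`. [folklore] -/
theorem spectralForm_le_of_symbol_le {q κ : ℝ} (hq : 0 < q) {f : ℝ → ℂ} (hf : Integrable f) (hf2 : MemLp f 2)
    (hsym : ∀ z : ℝ, (∫ x : ℝ, f x * cexp (I * z * x)) ≠ 0 → 2 / q * liaSym (z * √q) ≤ -κ) :
    1 / (2 * π) * ∫ z : ℝ, (2 / q * liaSym (z * √q)) * ‖∫ x : ℝ, f x * cexp (I * z * x)‖ ^ 2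
      ≤ -κ * ∫ t : ℝ, ‖f t‖ ^ 2 := by
  set F : ℝ → ℂ := fun z => ∫ x : ℝ, f x * cexp (I * z * x) with hFdef
  have hpt : ∀ z : ℝ, (2 / q * liaSym (z * √q)) * ‖F z‖ ^ 2 ≤ (-κ) * ‖F z‖ ^ 2 := by
    intro z
    by_cases hz : F z = 0
    · simp [hz]
    · exact mul_le_mul_of_nonneg_right (hsym z hz) (by positivity)
  have hI2 : Integrable (fun z : ℝ => ‖F z‖ ^ 2) := integrable_norm_sq_unnormalisedTransform hf hf2
  have hIl : Integrable (fun z : ℝ => (2 / q * liaSym (z * √q)) * ‖F z‖ ^ 2) := by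
    refine hI2.bdd_mul (c := 2 / q * 4) ?_ (Eventually.of_forall fun z => ?_)
    · exact ((continuous_const.mul (continuous_liaSym.comp (continuous_id.mul continuous_const))).aestronglyMeasurable)
    · rw [Real.norm_eq_abs, abs_mul, abs_of_pos (by positivity : (0:ℝ) < 2 / q)]
      exact mul_le_mul_of_nonneg_left (abs_liaSym_le_four _) (by positivity)
  have hmono := integral_mono hIl (hI2.const_mul (-κ)) hpt
  rw [integral_const_mul] at hmono
  have hplanch : 1 / (2 * π) * ∫ z : ℝ, ‖F z‖ ^ 2 = ∫ t : ℝ, ‖f t‖ ^ 2 := by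
    rw [← Literature.Analysis.FunctionSpaces.integral_norm_sq_fourierIntegral_eq hf hf2, integral_norm_sq_fourier_eq_unnormalised]
  have hpos : (0 : ℝ) < 1 / (2 * π) := by positivity
  calc 1 / (2 * π) * ∫ z : ℝ, (2 / q * liaSym (z * √q)) * ‖F z‖ ^ 2
      ≤ 1 / (2 * π) * ((-κ) * ∫ z : ℝ, ‖F z‖ ^ 2) := mul_le_mul_of_nonneg_left hmono hpos.le
    _ = -κ * (1 / (2 * π) * ∫ z : ℝ, ‖F z‖ ^ 2) := by ring
    _ = -κ * ∫ t : ℝ, ‖f t‖ ^ 2 := by rw [hplanch]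

/-- **Positive window, spectral side**: if `κ ≤ (2/q)𝔖(z√q)` wherever `Ŷ(z) ≠ 0` then `κ·∫‖Y‖² ≤ (1/2π)∫(2/q)𝔖(z√q)|Ŷ|²`. [folklore] -/
theorem spectralForm_ge_of_symbol_ge {q κ : ℝ} (hq : 0 < q) {f : ℝ → ℂ} (hf : Integrable f) (hf2 : MemLp f 2)
    (hsym : ∀ z : ℝ, (∫ x : ℝ, f x * cexp (I * z * x)) ≠ 0 → κ ≤ 2 / q * liaSym (z * √q)) :
    κ * ∫ t : ℝ, ‖f t‖ ^ 2
      ≤ 1 / (2 * π) * ∫ z : ℝ, (2 / q * liaSym (z * √q)) * ‖∫ x : ℝ, f x * cexp (I * z * x)‖ ^ 2 := by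
  set F : ℝ → ℂ := fun z => ∫ x : ℝ, f x * cexp (I * z * x) with hFdef
  have hpt : ∀ z : ℝ, κ * ‖F z‖ ^ 2 ≤ (2 / q * liaSym (z * √q)) * ‖F z‖ ^ 2 := by
    intro z
    by_cases hz : F z = 0
    · simp [hz]
    · exact mul_le_mul_of_nonneg_right (hsym z hz) (by positivity)
  have hI2 : Integrable (fun z : ℝ => ‖F z‖ ^ 2) := integrable_norm_sq_unnormalisedTransform hf hf2
  have hIl : Integrable (fun z : ℝ => (2 / q * liaSym (z * √q)) * ‖F z‖ ^ 2) := by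
    refine hI2.bdd_mul (c := 2 / q * 4) ?_ (Eventually.of_forall fun z => ?_)
    · exact ((continuous_const.mul (continuous_liaSym.comp (continuous_id.mul continuous_const))).aestronglyMeasurable)
    · rw [Real.norm_eq_abs, abs_mul, abs_of_pos (by positivity : (0:ℝ) < 2 / q)]
      exact mul_le_mul_of_nonneg_left (abs_liaSym_le_four _) (by positivity)
  have hmono := integral_mono (hI2.const_mul κ) hIl hpt
  rw [integral_const_mul] at hmono
  have hplanch : 1 / (2 * π) * ∫ z : ℝ, ‖F z‖ ^ 2 = ∫ t : ℝ, ‖f t‖ ^ 2 := by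
    rw [← Literature.Analysis.FunctionSpaces.integral_norm_sq_fourierIntegral_eq hf hf2, integral_norm_sq_fourier_eq_unnormalised]
  have hpos : (0 : ℝ) < 1 / (2 * π) := by positivity
  calc κ * ∫ t : ℝ, ‖f t‖ ^ 2 = κ * (1 / (2 * π) * ∫ z : ℝ, ‖F z‖ ^ 2) := by rw [hplanch]
    _ = 1 / (2 * π) * (κ * ∫ z : ℝ, ‖F z‖ ^ 2) := by ring
    _ ≤ 1 / (2 * π) * ∫ z : ℝ, (2 / q * liaSym (z * √q)) * ‖F z‖ ^ 2 := mul_le_mul_of_nonneg_left hmono hpos.le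

/-- Negative window for `Re 𝔔_ℂ`. [folklore] -/
theorem modelSelfForm_re_le_of_symbol_le {q κ : ℝ} (hq : 0 < q) {f : ℝ → ℂ} (hf : Integrable f) (hf2 : MemLp f 2)
    (hsym : ∀ z : ℝ, (∫ x : ℝ, f x * cexp (I * z * x)) ≠ 0 → 2 / q * liaSym (z * √q) ≤ -κ) :
    ((2 / q : ℂ) * (∫ t : ℝ, conj (f t) * f t)
      - ∫ t : ℝ, ∫ u : ℝ, ((((2 * q - (t - u) ^ 2) * (((t - u) ^ 2 + q) ^ (5 / 2 : ℝ))⁻¹ : ℝ)) : ℂ) * f u * conj (f t)).re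
      ≤ -κ * ∫ t : ℝ, ‖f t‖ ^ 2 := by
  rw [modelSelfForm_eq_spectral hq hf hf2, Complex.ofReal_re]
  exact spectralForm_le_of_symbol_le hq hf hf2 hsym

/-- Positive window for `Re 𝔔_ℂ`. [folklore] -/
theorem modelSelfForm_re_ge_of_symbol_ge {q κ : ℝ} (hq : 0 < q) {f : ℝ → ℂ} (hf : Integrable f) (hf2 : MemLp f 2)
    (hsym : ∀ z : ℝ, (∫ x : ℝ, f x * cexp (I * z * x)) ≠ 0 → κ ≤ 2 / q * liaSym (z * √q)) :
    κ * ∫ t : ℝ, ‖f t‖ ^ 2 ≤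
      ((2 / q : ℂ) * (∫ t : ℝ, conj (f t) * f t)
        - ∫ t : ℝ, ∫ u : ℝ, ((((2 * q - (t - u) ^ 2) * (((t - u) ^ 2 + q) ^ (5 / 2 : ℝ))⁻¹ : ℝ)) : ℂ) * f u * conj (f t)).re := by
  rw [modelSelfForm_eq_spectral hq hf hf2, Complex.ofReal_re]
  exact spectralForm_ge_of_symbol_ge hq hf hf2 hsym

/-! ## §2 The generic elliptic-window estimate for the full model operator -/

/-- **ELLIPTIC WINDOW ESTIMATE (one-signed symbol of size `≥ κ` on the spectrum).**  Under the hypotheses of `model_selfForm_bound` plus `Y ∈ L¹` and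
EITHER `(2/q)𝔖(z√q) ≤ −κ` OR `κ ≤ (2/q)𝔖(z√q)` wherever `Ŷ(z) ≠ 0`:
`G·κ·∫‖Y‖² ≤ ((∫‖𝓛Y‖²)^{1/2} + Λ(∫‖(τ−c)Y′‖²)^{1/2} + (b₁+b₂)(∫‖Y‖²)^{1/2})·(∫‖Y‖²)^{1/2}`. [folklore] -/
theorem model_window_estimate {q G κ : ℝ} (hq : 0 < q) (hG : 0 < G) {Y Y' : ℝ → ℂ} (hY1 : Integrable Y) (hY2 : MemLp Y 2)
    (hY'm : AEStronglyMeasurable Y' volume) (c : ℝ) (hwY'2 : MemLp (fun τ : ℝ => ((τ - c : ℝ) : ℂ) * Y' τ) 2)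
    (hM2 : MemLp (fun τ : ℝ => (2 / q : ℂ) * Y τ
      - ∫ σ : ℝ, ((((2 * q - (τ - σ) ^ 2) * (((τ - σ) ^ 2 + q) ^ (5 / 2 : ℝ))⁻¹ : ℝ)) : ℂ) * Y σ) 2)
    (hsym : (∀ z : ℝ, (∫ x : ℝ, Y x * cexp (I * z * x)) ≠ 0 → 2 / q * liaSym (z * √q) ≤ -κ) ∨
      (∀ z : ℝ, (∫ x : ℝ, Y x * cexp (I * z * x)) ≠ 0 → κ ≤ 2 / q * liaSym (z * √q)))
    {w : ℝ → ℝ} (hw : Differentiable ℝ w) {Λ : ℝ} (hΛ : ∀ t, |deriv w t| ≤ Λ) (hwc : w c = 0)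
    {β₁ β₂ : ℝ → ℂ} (hβ₁m : AEStronglyMeasurable β₁ volume) (hβ₂m : AEStronglyMeasurable β₂ volume) {b₁ b₂ : ℝ}
    (hb₁ : ∀ τ, ‖β₁ τ‖ ≤ b₁) (hb₂ : ∀ τ, ‖β₂ τ‖ ≤ b₂) :
    G * κ * ∫ t : ℝ, ‖Y t‖ ^ 2
      ≤ ((∫ τ : ℝ, ‖I * (G : ℂ) * ((2 / q : ℂ) * Y τ
              - ∫ σ : ℝ, ((((2 * q - (τ - σ) ^ 2) * (((τ - σ) ^ 2 + q) ^ (5 / 2 : ℝ))⁻¹ : ℝ)) : ℂ) * Y σ)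
            - ((w τ : ℝ) : ℂ) * Y' τ + β₁ τ * Y τ + β₂ τ * conj (Y τ)‖ ^ 2) ^ (1 / 2 : ℝ)
          + Λ * (∫ τ : ℝ, ‖((τ - c : ℝ) : ℂ) * Y' τ‖ ^ 2) ^ (1 / 2 : ℝ)
          + (b₁ + b₂) * (∫ τ : ℝ, ‖Y τ‖ ^ 2) ^ (1 / 2 : ℝ))
        * (∫ τ : ℝ, ‖Y τ‖ ^ 2) ^ (1 / 2 : ℝ) := by
  have hbd := model_selfForm_bound (q := q) hG hY2 hY'm c hwY'2 hM2 hw hΛ hwc hβ₁m hβ₂m hb₁ hb₂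
  refine le_trans ?_ hbd
  rw [mul_assoc]
  refine mul_le_mul_of_nonneg_left ?_ hG.le
  rcases hsym with hneg | hpos
  · have h := modelSelfForm_re_le_of_symbol_le hq hY1 hY2 hneg
    have : κ * ∫ t : ℝ, ‖Y t‖ ^ 2 ≤ -((2 / q : ℂ) * (∫ t : ℝ, conj (Y t) * Y t)
        - ∫ t : ℝ, ∫ u : ℝ, ((((2 * q - (t - u) ^ 2) * (((t - u) ^ 2 + q) ^ (5 / 2 : ℝ))⁻¹ : ℝ)) : ℂ) * Y u * conj (Y t)).re := by
      linarith
    exact this.trans (neg_le_abs _)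
  · exact (modelSelfForm_re_ge_of_symbol_ge hq hY1 hY2 hpos).trans (le_abs_self _)

end Summit.NavierStokesRegularity.NavierStokesRegularity.Theorems.MatchedKernel

end
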